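import Summits.BirchSwinnertonDyer.Rank1Residual.Ordinary.CyclicSylowDivisibility
import Summits.BirchSwinnertonDyer.Rank1Residual.Ordinary.LocalPointsIdentification
import HarnessLib

/-!
# A finite abelian group with cyclic `p`-Sylow subgroup has `G/p^n·G ≅ ℤ/p^n` for `n ≤ v_p #G`: the
# identification `Ẽ(𝔽_ℓ)/p^n ≅ ℤ/p^n` at a cyclic depth-`n` level EXISTS (the rank-one freeness of the local
# condition at `ℓ` in C-16's derivation; theorems only — no definition, no named fact, nothing asserted about
# any curve's BSD; C-16 stays a CONJECTURE)

HONEST FRAMING (cell `b2b-bsdres`, run/shared/lean/b2b/bsd-rank1-residual/, verbatim in every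
file): the goal of the cell is to DELETE the COMBINATION-SHAPED residual classes of the
Birch–Swinnerton-Dyer formula for ALL analytic-rank `≤ 1` elliptic curves over `ℚ` — "full BSD
formula for every rank `≤ 1` curve in class `C`" assembled STRICTLY from published theorems — so
that the rank-`≤ 1` remainder becomes exactly the CONSTRUCTION-SHAPED classes, which are TYPED
(missing-input `Prop`s), NOT attempted. This is not "finishing BSD". Seat `b2b-bsdres-additive-p3`
(X8 prover B / X7 joint; typer-designate for the cell conjecture C-16 = hyp C120.1 by hyp R-16 (e)).
This file books nothing and moves no mark; X7 / X8 stay CONSTRUCTION-SHAPED.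

## What this file does

`Ordinary/LocalClassOrders.lean` and `Ordinary/Conjectures/KuriharaExactOrderFromReciprocity.lean` quantify over
identifications `φ_ℓ : Ẽ(𝔽_ℓ) ↠ ℤ/p^n` with kernel `p^n·Ẽ(𝔽_ℓ)`; `Ordinary/LocalPointsIdentification.lean` proved
that the `p`-side identification exists. This file proves the `ℓ`-side existence, as pure group theory:
* §1 (`#G[p] ≤ p`, `e = v_p #G ≥ 1`): `#G[p^i] ≤ p^i`, `#G[p^e] = p^e`, and `G[p^e] = ℤ·w` for some `w` of order
  `p^e` — public restatements of the sibling `CyclicSylowDivisibility`'s private §1b (proofs adapted verbatim);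
* §2 `exists_generates_mod_pow`: for `n ≤ e` there is `x ∈ G` with **every `R = c·x + p^n·Q`** (`c ∈ ℤ`) and the
  uniqueness clause **`c·x ∈ p^n·G ⇒ p^n ∣ c`** (the prime-to-`p` part `m′ = #G/p^e` projects onto `G[p^e] = ℤ·w`,
  a Bézout inverse of `m′` modulo `p^e` undoes it modulo `p^n·G`);
* §3 `exists_addMonoidHom_zmod_pow_of_card_torsion_le`: hence **`∃ φ : G →+ ℤ/p^n`, surjective, kernel `p^n·G`**
  (sibling `exists_addMonoidHom_zmod_of_generates`) — `G/p^n·G ≅ ℤ/p^n`;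
* §4 on the reduction at a good prime `ℓ` with `#Ẽ(𝔽_ℓ)[p] ≤ p` (points read on the residue field of `ℤ_ℓ`, as in
  the vocabulary file) and `n ≤ e_ℓ = v_p #Ẽ(𝔽_ℓ)`: the identification `φ_ℓ : Ẽ(𝔽_ℓ) ↠ ℤ/p^n` with kernel
  `p^n·Ẽ(𝔽_ℓ)` EXISTS (`exists_addMonoidHom_zmod_pow_reduction`) — the skeleton's `φ_ℓ` is never vacuous at a
  cyclic depth-`n` Kolyvagin level (Kim 2022 Thm. 2.1: "`T/(Fr_ℓ − 1)T` free of rank one").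

References: standard finite abelian group theory [folklore]; J. H. Silverman, AEC (2009) VII.2.1 for the
reduction dictionary (through the siblings) [SilvermanAEC2009]; C.-H. Kim, arXiv:2203.12159, Thm. 2.1
[Kim2022StructureSelmer]; `R1-DEPTH-LAW.md` §1–§2.
-/

noncomputable section

open scoped Classical

open WeierstrassCurve Literature.NumberTheory.EllipticCurves

namespace Summit.BirchSwinnertonDyer.Rank1Residual.Ordinary

/-! ### §1 Torsion counts under `#G[p] ≤ p` (public forms of the sibling's private §1b) -/

section Torsion

variable {G : Type*} [AddCommGroup G] {p : ℕ}

/-- Membership in `G[n] = ker (n • ·)`. [folklore] -/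
private theorem mem_tors' {n : ℕ} {x : G} : x ∈ (DistribSMul.toAddMonoidHom G n).ker ↔ n • x = 0 :=
  Iff.rfl

variable [Finite G]

/-- `#G[p^{i+1}] ≤ p · #G[p^i]` (multiplication by `p` maps `G[p^{i+1}]` to `G[p^i]` with kernel inside `G[p]`;
adapted from the sibling `CyclicSylowDivisibility` §1b, private there). [folklore] -/
theorem natCard_ker_pow_succ_le (hcyc : Nat.card {x : G // p • x = 0} ≤ p) (i : ℕ) :
    Nat.card ((DistribSMul.toAddMonoidHom G (p ^ (i + 1))).ker) ≤
      p * Nat.card ((DistribSMul.toAddMonoidHom G (p ^ i)).ker) := by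
  let φ : (DistribSMul.toAddMonoidHom G (p ^ (i + 1))).ker →+
      (DistribSMul.toAddMonoidHom G (p ^ i)).ker :=
    { toFun := fun x => ⟨p • (x : G), by
        have hx : p ^ (i + 1) • (x : G) = 0 := mem_tors'.mp x.2
        rw [mem_tors', smul_smul, ← pow_succ, hx]⟩
      map_zero' := by ext; simp
      map_add' := fun x y => by ext; simp [smul_add] }
  have hkerφ : ∀ x : (DistribSMul.toAddMonoidHom G (p ^ (i + 1))).ker,
      x ∈ φ.ker ↔ p • (x : G) = 0 := fun x => by
    rw [AddMonoidHom.mem_ker]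
    exact ⟨fun h => congrArg Subtype.val h, fun h => Subtype.ext h⟩
  have hker : Nat.card φ.ker ≤ p := by
    refine le_trans (Nat.card_le_card_of_injective
      (fun x : φ.ker =>
        (⟨((x : (DistribSMul.toAddMonoidHom G (p ^ (i + 1))).ker) : G), (hkerφ _).mp x.2⟩ :
          {x : G // p • x = 0}))
      ?_) hcyc
    intro a b h
    simp only [Subtype.mk.injEq] at h
    exact Subtype.ext (Subtype.ext h)
  have h1 : Nat.card ((DistribSMul.toAddMonoidHom G (p ^ (i + 1))).ker) =
      Nat.card φ.ker * Nat.card φ.range := by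
    rw [φ.ker.card_eq_card_quotient_mul_card_addSubgroup, mul_comm,
      Nat.card_congr (QuotientAddGroup.quotientKerEquivRange φ).toEquiv]
  have h2 : Nat.card φ.range ≤ Nat.card ((DistribSMul.toAddMonoidHom G (p ^ i)).ker) :=
    Nat.card_le_card_of_injective _ Subtype.val_injective
  rw [h1]
  exact Nat.mul_le_mul hker h2

/-- **`#G[p^i] ≤ p^i`** under `#G[p] ≤ p`. [folklore] -/
theorem natCard_ker_pow_le (hcyc : Nat.card {x : G // p • x = 0} ≤ p) (i : ℕ) :
    Nat.card ((DistribSMul.toAddMonoidHom G (p ^ i)).ker) ≤ p ^ i := by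
  induction i with
  | zero =>
    have h : (DistribSMul.toAddMonoidHom G (p ^ 0)).ker = ⊥ := by
      ext x
      rw [mem_tors', pow_zero, one_smul, AddSubgroup.mem_bot]
    rw [h, AddSubgroup.card_bot, pow_zero]
  | succ i ih =>
    refine (natCard_ker_pow_succ_le hcyc i).trans ?_
    rw [pow_succ']
    exact Nat.mul_le_mul_left _ ih

variable [hp : Fact p.Prime]

/-- **`#G[p^e] = p^e`** for `e = v_p #G`, under `#G[p] ≤ p`. [folklore] -/
theorem natCard_ker_pow_padicValNat_eq (hcyc : Nat.card {x : G // p • x = 0} ≤ p) :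
    Nat.card (DistribSMul.toAddMonoidHom G (p ^ padicValNat p (Nat.card G))).ker =
      p ^ padicValNat p (Nat.card G) := by
  set e := padicValNat p (Nat.card G) with he
  let ψ : G →+ G := DistribSMul.toAddMonoidHom G (p ^ e)
  have hG : Nat.card G =
      Nat.card ((DistribSMul.toAddMonoidHom G (p ^ e)).ker) * Nat.card ψ.range := by
    rw [ψ.ker.card_eq_card_quotient_mul_card_addSubgroup, mul_comm,
      Nat.card_congr (QuotientAddGroup.quotientKerEquivRange ψ).toEquiv]
  have hndvd : ¬ p ∣ Nat.card ψ.range := by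
    intro hdvd
    obtain ⟨z, hz⟩ := exists_prime_addOrderOf_dvd_card' p hdvd
    obtain ⟨w, hw⟩ := AddMonoidHom.mem_range.mp z.2
    have hzG : addOrderOf (z : G) = p := by rw [AddSubgroup.addOrderOf_coe, hz]
    have hle := padicValNat_addOrderOf_add_le_of_pow_smul_eq (G := G) (p := p) (j := e)
      (x := (z : G)) (y := w) le_rfl hw
    rw [hzG, padicValNat_self] at hle
    omega
  have hcop : Nat.Coprime (p ^ e) (Nat.card ψ.range) :=
    Nat.Coprime.pow_left _ ((Nat.Prime.coprime_iff_not_dvd hp.out).mpr hndvd)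
  have hdvd : p ^ e ∣ Nat.card ((DistribSMul.toAddMonoidHom G (p ^ e)).ker) := by
    have h : p ^ e ∣ Nat.card ((DistribSMul.toAddMonoidHom G (p ^ e)).ker) * Nat.card ψ.range := by
      rw [← hG]
      exact pow_padicValNat_dvd
    exact hcop.dvd_of_dvd_mul_right h
  exact le_antisymm (natCard_ker_pow_le hcyc e) (Nat.le_of_dvd Nat.card_pos hdvd)

/-- **`G[p^e] = ℤ·w` with `ord w = p^e`** (`e = v_p #G ≥ 1`, `#G[p] ≤ p`): the `p`-Sylow subgroup is cyclic.
[folklore] -/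
theorem exists_addOrderOf_eq_ker_eq_zmultiples (hcyc : Nat.card {x : G // p • x = 0} ≤ p)
    (he : 1 ≤ padicValNat p (Nat.card G)) :
    ∃ w : G, addOrderOf w = p ^ padicValNat p (Nat.card G) ∧
      (DistribSMul.toAddMonoidHom G (p ^ padicValNat p (Nat.card G))).ker =
        AddSubgroup.zmultiples w := by
  set e := padicValNat p (Nat.card G) with he'
  have hle : (DistribSMul.toAddMonoidHom G (p ^ (e - 1))).ker ≤
      (DistribSMul.toAddMonoidHom G (p ^ e)).ker := fun x hx => by
    rw [mem_tors'] at hx ⊢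
    rw [← Nat.sub_add_cancel he, pow_succ', ← smul_smul, hx, smul_zero]
  have hlt : (DistribSMul.toAddMonoidHom G (p ^ (e - 1))).ker <
      (DistribSMul.toAddMonoidHom G (p ^ e)).ker := by
    refine lt_of_le_of_ne hle fun h => ?_
    have h1 := natCard_ker_pow_le hcyc (e - 1)
    rw [h, natCard_ker_pow_padicValNat_eq hcyc] at h1
    exact absurd h1 (not_le.mpr (Nat.pow_lt_pow_right hp.out.one_lt (by omega)))
  obtain ⟨w, hw1, hw2⟩ := SetLike.exists_of_lt hlt
  rw [mem_tors'] at hw1 hw2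
  have hord : addOrderOf w = p ^ e := by
    have h := addOrderOf_eq_prime_pow (p := p) (n := e - 1) (x := w) hw2
      (by rw [Nat.sub_add_cancel he]; exact hw1)
    rwa [Nat.sub_add_cancel he] at h
  refine ⟨w, hord, ?_⟩
  symm
  apply AddSubgroup.eq_of_le_of_card_ge
  · rw [AddSubgroup.zmultiples_le, mem_tors']
    exact hw1
  · rw [natCard_ker_pow_padicValNat_eq hcyc, Nat.card_zmultiples, hord]

end Torsion

/-! ### §2 A generator of `G/p^n·G` with the uniqueness clause -/

section Generates

variable {G : Type*} [AddCommGroup G] [Finite G] {p : ℕ} [hp : Fact p.Prime]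

/-- **`G/p^n·G` is cyclic of order `p^n`, in generator form**: for `n ≤ e = v_p #G` and `#G[p] ≤ p` there is
`x ∈ G` such that every `R ∈ G` is `c·x + p^n·Q` (`c ∈ ℤ`), and `c·x ∈ p^n·G ⇒ p^n ∣ c`. (`x = w` generates
`G[p^e] = ℤ·w`; `m′ = #G / p^e` maps `G` onto `G[p^e]`, and a Bézout inverse of `m′` modulo `p^e` corrects it
modulo `p^n·G`.) [folklore] -/
theorem exists_generates_mod_pow (hcyc : Nat.card {x : G // p • x = 0} ≤ p) {n : ℕ}
    (hn : n ≤ padicValNat p (Nat.card G)) :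
    ∃ x : G, (∀ R : G, ∃ (c : ℤ) (Q : G), R = c • x + (p ^ n) • Q) ∧
      (∀ (c : ℤ) (Q : G), c • x = (p ^ n) • Q → ((p ^ n : ℕ) : ℤ) ∣ c) := by
  set e := padicValNat p (Nat.card G) with he
  rcases Nat.eq_zero_or_pos e with he0 | hepos
  · -- `e = 0`: `n = 0`, `ℤ/p^0 = 0`, everything is divisible
    have hn0 : n = 0 := by omega
    subst hn0
    refine ⟨0, fun R => ⟨0, R, by rw [zero_smul, zero_add, pow_zero, one_smul]⟩, fun c Q _ => ?_⟩
    rw [pow_zero, Nat.cast_one]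
    exact one_dvd c
  have he1 : 1 ≤ e := hepos
  obtain ⟨w, hord, hker⟩ := exists_addOrderOf_eq_ker_eq_zmultiples hcyc he1
  -- `#G = p^e · m′`, `p ∤ m′`
  set N := Nat.card G with hN
  have hN0 : N ≠ 0 := Nat.card_pos.ne'
  set m' := N / p ^ e with hm'
  have hNm : p ^ e * m' = N := Nat.mul_div_cancel' pow_padicValNat_dvd
  have hcopm : Nat.Coprime p m' := by
    have h := Nat.coprime_ordCompl hp.out hN0
    rwa [Nat.factorization_def N hp.out] at h
  -- `m′ • R ∈ G[p^e] = ℤ·w`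
  have hproj : ∀ R : G, ∃ k : ℤ, k • w = m' • R := fun R => by
    have hmem : m' • R ∈ (DistribSMul.toAddMonoidHom G (p ^ e)).ker := by
      rw [AddMonoidHom.mem_ker]
      show p ^ e • m' • R = 0
      rw [smul_smul, hNm, hN]
      exact (addOrderOf_dvd_iff_nsmul_eq_zero.mp (addOrderOf_dvd_natCard R))
    rw [hker, AddSubgroup.mem_zmultiples_iff] at hmem
    exact hmem
  -- Bézout: `m′ · a ≡ 1 (mod p^e)`
  have hpe1 : 1 < p ^ e := Nat.one_lt_pow (by omega) hp.out.one_lt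
  obtain ⟨a, -, ha⟩ := Nat.exists_mul_mod_eq_one_of_coprime
    (Nat.Coprime.pow_right e hcopm.symm) hpe1
  set d := m' * a / p ^ e with hd
  have hda : m' * a = p ^ e * d + 1 := by
    have h := Nat.div_add_mod (m' * a) (p ^ e)
    rw [ha] at h
    rw [hd]
    omega
  refine ⟨w, fun R => ?_, fun c Q hcQ => ?_⟩
  · obtain ⟨k, hk⟩ := hproj R
    -- `(m′ a) • R = R + p^e • (d • R)` and `(m′ a) • R = a • (k • w)`
    have h1 : (m' * a) • R = R + p ^ e • (d • R) := by
      rw [hda, add_smul, one_smul, mul_smul, add_comm]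
    have h2 : (m' * a) • R = ((a : ℤ) * k) • w := by
      rw [mul_comm, mul_smul, ← hk, ← natCast_zsmul, smul_smul]
    refine ⟨(a : ℤ) * k, -(p ^ (e - n) • (d • R)), ?_⟩
    rw [smul_neg, smul_smul, ← pow_add, Nat.add_sub_cancel' hn, ← h2, h1]
    abel
  · -- uniqueness: project with `m′`, read in `ℤ·w` (order `p^e`), use `gcd(p^n, m′) = 1`
    obtain ⟨j, hj⟩ := hproj Q
    have h1 : ((m' : ℤ) * c) • w = ((p ^ n : ℕ) : ℤ) • (j • w) := by
      rw [mul_smul, natCast_zsmul, hcQ, smul_comm, hj, natCast_zsmul]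
    have h2 : ((m' : ℤ) * c - (p ^ n : ℕ) * j) • w = 0 := by
      rw [sub_smul, h1, mul_smul, sub_self]
    have h3 : ((p ^ e : ℕ) : ℤ) ∣ (m' : ℤ) * c - (p ^ n : ℕ) * j := by
      rw [← hord]
      exact addOrderOf_dvd_iff_zsmul_eq_zero.mpr h2
    have h4 : ((p ^ n : ℕ) : ℤ) ∣ (m' : ℤ) * c := by
      have h5 : ((p ^ n : ℕ) : ℤ) ∣ ((p ^ e : ℕ) : ℤ) := by
        exact_mod_cast pow_dvd_pow p hn
      have h6 := h5.trans h3
      have h7 : ((p ^ n : ℕ) : ℤ) ∣ ((p ^ n : ℕ) : ℤ) * j := dvd_mul_right _ _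
      have h8 := dvd_add h6 h7
      rwa [sub_add_cancel] at h8
    have hgcd : Int.gcd ((p ^ n : ℕ) : ℤ) (m' : ℤ) = 1 := by
      rw [Int.gcd_natCast_natCast]
      exact Nat.Coprime.pow_left n hcopm
    exact Int.dvd_of_dvd_mul_right_of_gcd_one h4 hgcd

end Generates

/-! ### §3 The identification `G/p^n·G ≅ ℤ/p^n` exists -/

section Identification

variable {G : Type*} [AddCommGroup G] [Finite G] {p : ℕ} [hp : Fact p.Prime]

/-- **`∃ φ : G →+ ℤ/p^n`, surjective, with kernel exactly `p^n·G`**, for a finite abelian group with `#G[p] ≤ p`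
and `n ≤ v_p #G`. [folklore] -/
theorem exists_addMonoidHom_zmod_pow_of_card_torsion_le (hcyc : Nat.card {x : G // p • x = 0} ≤ p)
    {n : ℕ} (hn : n ≤ padicValNat p (Nat.card G)) :
    ∃ φ : G →+ ZMod (p ^ n), Function.Surjective φ ∧ ∀ g : G, φ g = 0 ↔ ∃ h : G, p ^ n • h = g := by
  haveI : NeZero (p ^ n) := ⟨pow_ne_zero n hp.out.ne_zero⟩
  obtain ⟨x, hgen, huniq⟩ := exists_generates_mod_pow hcyc hn
  obtain ⟨φ, hφ, hkerφ, _⟩ := exists_addMonoidHom_zmod_of_generates (q := p ^ n) x hgen huniq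
  exact ⟨φ, hφ, hkerφ⟩

end Identification

/-! ### §4 On the reduction at a good prime with cyclic `p`-torsion -/

section Reduction

variable (W : WeierstrassCurve ℚ) [W.IsGloballyMinimal] (p ℓ : ℕ) [Fact p.Prime] [Fact ℓ.Prime]

/-- **The skeleton's `φ_ℓ` EXISTS at a cyclic depth-`n` level**: with `#Ẽ(𝔽_ℓ)[p] ≤ p` (points read on the
residue field of `ℤ_ℓ`) and `n ≤ e_ℓ = v_p #Ẽ(𝔽_ℓ)`, there is a surjective additive
`φ : Ẽ(𝔽_ℓ) → ℤ/p^n` with kernel `p^n·Ẽ(𝔽_ℓ)` — `H¹_f(ℚ_ℓ, E[p^n]) = Ẽ(𝔽_ℓ)/p^n ≅ ℤ/p^n` in group form.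
[cite: Kim2022StructureSelmer, Thm. 2.1 (§2.2)] -/
theorem exists_addMonoidHom_zmod_pow_reduction
    (hcyc : Nat.card {c : (((integralModelInt W).map (Int.castRingHom ℤ_[ℓ])).map
      (IsLocalRing.residue ℤ_[ℓ])).toAffine.Point // p • c = 0} ≤ p)
    {n : ℕ} (hn : n ≤ padicValNat p (W.reductionPointCount ℓ)) :
    ∃ φ : (((integralModelInt W).map (Int.castRingHom ℤ_[ℓ])).map
        (IsLocalRing.residue ℤ_[ℓ])).toAffine.Point →+ ZMod (p ^ n),
      Function.Surjective φ ∧ ∀ g, φ g = 0 ↔ ∃ h, p ^ n • h = g := by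
  haveI : Finite (((integralModelInt W).map (Int.castRingHom ℤ_[ℓ])).map
      (IsLocalRing.residue ℤ_[ℓ])).toAffine.Point :=
    Nat.finite_of_card_ne_zero (by
      rw [W.natCard_point_padicModel_residue ℓ, reductionPointCount]
      haveI : NeZero ℓ := ⟨(Fact.out : ℓ.Prime).ne_zero⟩
      exact Nat.card_pos.ne')
  rw [← W.natCard_point_padicModel_residue ℓ] at hn
  exact exists_addMonoidHom_zmod_pow_of_card_torsion_le hcyc hn

end Reduction

end Summit.BirchSwinnertonDyer.Rank1Residual.Ordinary

end
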